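import Summits.Ventures.LatticeQCDFlow.Exactness.Phi4FlowSignMagnetisation
import HarnessLib

/-!
# The flow arm slows down EXPONENTIALLY in the forward relative entropy: `1/κ ≥ e^{D(π‖q̃)}`, `τ_int(sign) ≥ e^{D(π‖q̃)} − ½`

HONEST FRAMING: exact (Metropolis-corrected) sampling algorithms for lattice gauge theory;
figures of merit are autocorrelation/cost numbers at stated couplings and volumes; no
continuum-physics claim.  (SCALAR calibration rung S0-A: not a gauge result.)

Venture `LatticeQCDFlow` (cell pub-lqcd), topic `Exactness`; FANOUT row 2 (`s0-phi4`, FLOW arm).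
NEW WORK of the cell over row 2's `IMHSignObservableSandwich` (`1/κ − ½ ≤ τ_int` for every balanced
sign observable, `1/κ = W₂/Z²` the inverse Kish ESS fraction) and `Phi4FlowSignMagnetisation` (the sign
of the magnetisation is such an observable for φ⁴).  Gen-14's `FlowSamplerLogWeightCSD` listed
"exponential (in `σ²`) slowing down of flows" as NOT CLAIMED — its Caracciolo–Pelissetto–Sokal floor is
quadratic in the log-weight; here is the exponential law, in the forward relative entropy of target
from model.  Nothing is cited as a fact.  Printed counterparts, NAMED ONLY: Chatterjee–Diaconis 2018
(the sample size of importance sampling is `≈ e^{D(π‖q)}`), Agapiou–Papaspiliopoulos–Sanz-Alonso–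
Stuart 2017; in this tree, on finite spaces / via `klDiv`, `Theory2.essFrac_le_exp_neg_kl` and
`Theory2.essM_le_mul_exp_neg_klDiv` (theory-2: `ESS ≤ C e^{−D(μ‖η)}` for a model of density `≤ C`
w.r.t. a reference `η`; the case `η = q̃`, `C = 1` is the inequality below, here in the density
vocabulary of row 2's flow files and carried to `τ_int`).

Setting (general measurable space `(X, μ)`, `μ` s-finite): target weight `w > 0` (`Z = ∫ w`,
`π = w/Z`), model density `q > 0` with `∫ q = 1`, importance weight `b = w/q`, `W₂ = ∫ b w`,
`κ = Z²/W₂`; the forward relative entropy in density form `D(π‖q) = Z⁻¹ ∫ w log(w/(Z q)) dμ`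
(`= ∫ π log(π/q)`).

## What is proved

* **`weightMoment_ge_exp_kl`** — `W₂/Z² ≥ exp(D(π‖q))`, i.e. **`κ ≤ e^{−D(π‖q)}`**, whenever
  `w log(w/(Zq))` is integrable (Jensen for `exp` under `π`, via the tangent line at `a = D`: no
  convexity library, no change of measure);
* **`imhOp_sign_tauInt_ge_exp_kl`** — for every balanced sign observable `g` (`g² = 1`, `∫ g w = 0`)
  of the exact flow sampler with square-integrable weights: `τ_int(g) ≥ exp(D(π‖q)) − ½`;
* **`phi4Flow_signM_tauInt_ge_exp_kl`** — lattice φ⁴ (`λ > 0`, any `J`, every volume), EVERY positive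
  model density `q̃` with `∫ q̃ = 1`, `W₂ < ∞` and `e^{−S} log(e^{−S}/(Z q̃))` integrable:
  `τ_int(sgn M) ≥ exp(D(π‖q̃)) − ½` with `D(π‖q̃) = Z⁻¹ ∫ e^{−S}(−S − log Z − log q̃)`.

Reading for S0-A (no numerics implied): the exact flow sampler's tunnelling observable needs at least
`e^{D(π‖q̃)} − ½` steps per independent sign, where `D(π‖q̃) = ⟨−S − log q̃⟩_π − log Z` is the
FORWARD (inclusive) relative entropy of the trained model — for log-weights that are Gaussian with
variance `σ²` under the target this is `σ²/2`, and it is EXTENSIVE in the volume at fixed per-site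
model error: exponential critical slowing down of the flow arm in `V` unless the model error per site
falls like `V^{−1/2}`.  NOT CLAIMED: any value of `D` for a trained network (it is a measurable column:
the mean log-weight under the TARGET, e.g. from the HMC arm's configurations); the reverse entropy
`D(q̃‖π)` (the training loss), which floors the acceptance (`Scaling/AcceptancePinskerFloor`) but not
`τ_int`; smooth observables.
-/

namespace Summit.Ventures.LatticeQCDFlow.Exactness

open Real MeasureTheory Filter Set
open Summit.Ventures.LatticeQCDFlow.Scoring

section General

variable {X : Type*} [MeasurableSpace X] {μ : Measure X} {w q : X → ℝ}

/-- **`W₂/Z² ≥ exp(D(π‖q))` — the inverse ESS fraction is at least the exponential of the forward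
relative entropy** (`D = Z⁻¹ ∫ w log(w/(Z q))`; `w, q > 0`, `∫ q = 1`, `W₂ < ∞`, `w log(w/(Zq))`
integrable). -/
theorem weightMoment_ge_exp_kl (hw0 : ∀ t, 0 < w t) (hwi : Integrable w μ) (hq0 : ∀ t, 0 < q t)
    (hq1 : ∫ z, q z ∂μ = 1) (hW₂ : Integrable (fun x => w x / q x * w x) μ)
    (hKL : Integrable (fun x => w x * Real.log (w x / ((∫ z, w z ∂μ) * q x))) μ) :
    Real.exp ((∫ x, w x * Real.log (w x / ((∫ z, w z ∂μ) * q x)) ∂μ) / ∫ z, w z ∂μ)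
      ≤ (∫ x, w x / q x * w x ∂μ) / (∫ z, w z ∂μ) ^ 2 := by
  set Z : ℝ := ∫ z, w z ∂μ with hZdef
  have hZ : 0 < Z := integral_pos_of_pos hw0 hwi hq1
  set a : ℝ := (∫ x, w x * Real.log (w x / (Z * q x)) ∂μ) / Z with ha
  -- pointwise: `e^a (1 + ℓ − a) w ≤ e^ℓ w = (w/(Zq)) w`, `ℓ = log(w/(Zq))`
  have hpt : ∀ x, Real.exp a * (w x + w x * Real.log (w x / (Z * q x)) - a * w x)
      ≤ w x / q x * w x / Z := by
    intro x
    have hr : 0 < w x / (Z * q x) := div_pos (hw0 x) (mul_pos hZ (hq0 x))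
    -- tangent line of the exponential at `a`: `e^a (1 + ℓ − a) ≤ e^ℓ` (inlined; a folklore step)
    have h : Real.exp a * (1 + Real.log (w x / (Z * q x)) - a) ≤ w x / (Z * q x) := by
      have h1 := Real.add_one_le_exp (Real.log (w x / (Z * q x)) - a)
      calc Real.exp a * (1 + Real.log (w x / (Z * q x)) - a)
          = Real.exp a * (Real.log (w x / (Z * q x)) - a + 1) := by ring
        _ ≤ Real.exp a * Real.exp (Real.log (w x / (Z * q x)) - a) :=
            mul_le_mul_of_nonneg_left h1 (Real.exp_pos a).le
        _ = w x / (Z * q x) := by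
            rw [← Real.exp_add, show a + (Real.log (w x / (Z * q x)) - a) = Real.log (w x / (Z * q x))
              by ring, Real.exp_log hr]
    have hw := (hw0 x).le
    calc Real.exp a * (w x + w x * Real.log (w x / (Z * q x)) - a * w x)
        = (Real.exp a * (1 + Real.log (w x / (Z * q x)) - a)) * w x := by ring
      _ ≤ (w x / (Z * q x)) * w x := mul_le_mul_of_nonneg_right h hw
      _ = w x / q x * w x / Z := by
          field_simp
  have hI1 : Integrable (fun x => Real.exp a * (w x + w x * Real.log (w x / (Z * q x)) - a * w x)) μ :=
    ((hwi.add hKL).sub (hwi.const_mul a)).const_mul _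
  have hI2 : Integrable (fun x => w x / q x * w x / Z) μ := hW₂.div_const Z
  have hint := integral_mono hI1 hI2 hpt
  have h12 : Integrable (fun x => w x + w x * Real.log (w x / (Z * q x))) μ := hwi.add hKL
  have h3 : Integrable (fun x => a * w x) μ := hwi.const_mul a
  have e0 : ∫ x, (w x + w x * Real.log (w x / (Z * q x)) - a * w x) ∂μ
      = Z + (∫ x, w x * Real.log (w x / (Z * q x)) ∂μ) - a * Z := by
    rw [integral_sub h12 h3, integral_add hwi hKL, integral_const_mul]
  -- `∫ w + ∫ wℓ − a Z = Z` since `a Z = ∫ w ℓ`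
  have e : Z + (∫ x, w x * Real.log (w x / (Z * q x)) ∂μ) - a * Z = Z := by
    rw [ha, div_mul_cancel₀ _ hZ.ne']
    ring
  rw [integral_const_mul, e0, e, integral_div] at hint
  -- `e^a Z ≤ W₂/Z` ⇒ `e^a ≤ W₂/Z²`
  rw [le_div_iff₀ (pow_pos hZ 2)]
  calc Real.exp a * Z ^ 2 = Real.exp a * Z * Z := by ring
    _ ≤ (∫ x, w x / q x * w x ∂μ) / Z * Z := mul_le_mul_of_nonneg_right hint hZ.le
    _ = ∫ x, w x / q x * w x ∂μ := div_mul_cancel₀ _ hZ.ne'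

variable [SFinite μ]

/-- **`τ_int(g) ≥ exp(D(π‖q)) − ½` for every balanced sign observable of the exact flow sampler**
(square-integrable weights, `w log(w/(Zq))` integrable). -/
theorem imhOp_sign_tauInt_ge_exp_kl (hw0 : ∀ t, 0 < w t) (hwm : Measurable w)
    (hwi : Integrable w μ) (hq0 : ∀ t, 0 < q t) (hqm : Measurable q) (hqi : Integrable q μ)
    (hq1 : ∫ z, q z ∂μ = 1) (hW₂ : Integrable (fun x => w x / q x * w x) μ)
    (hKL : Integrable (fun x => w x * Real.log (w x / ((∫ z, w z ∂μ) * q x))) μ)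
    {g : X → ℝ} (hgm : Measurable g) (hg1 : ∀ t, g t ^ 2 = 1) (hg0 : ∫ x, g x * w x ∂μ = 0) :
    Real.exp ((∫ x, w x * Real.log (w x / ((∫ z, w z ∂μ) * q x)) ∂μ) / ∫ z, w z ∂μ) - 1 / 2
      ≤ tauInt (fun k => (∫ x, g x * ((imhOp μ w q)^[k] g) x * w x ∂μ)
          / ∫ x, g x ^ 2 * w x ∂μ) := by
  obtain ⟨hlow, -⟩ := imhOp_sign_tauInt_sandwich hw0 hwm hwi hq0 hqm hqi hq1 hW₂ hgm hg1 hg0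
  exact le_trans (sub_le_sub_right (weightMoment_ge_exp_kl hw0 hwi hq0 hq1 hW₂ hKL) _) hlow

end General

/-! ## The lattice: the sign of the magnetisation -/

section Lattice

variable {n : ℕ}

/-- **THE φ⁴ FLOW ARM SLOWS DOWN EXPONENTIALLY IN THE FORWARD RELATIVE ENTROPY**: for every `λ > 0`,
`J`, every positive model density `q̃` with `∫ q̃ = 1`, square-integrable weights and
`e^{−S} log(e^{−S}/(Z q̃))` integrable:
`τ_int(sgn M) ≥ exp(Z⁻¹ ∫ e^{−S} log(e^{−S}/(Z q̃))) − ½ = e^{D(π‖q̃)} − ½`. -/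
theorem phi4Flow_signM_tauInt_ge_exp_kl {lam : ℝ} (hlam : 0 < lam)
    (J : Fin (n + 1) → Fin (n + 1) → ℝ) {q : (Fin (n + 1) → ℝ) → ℝ} (hq0 : ∀ φ, 0 < q φ)
    (hqm : Measurable q) (hqi : Integrable q) (hq1 : ∫ φ, q φ = 1)
    (hW₂ : Integrable (fun φ => gibbsWeight J lam φ / q φ * gibbsWeight J lam φ))
    (hKL : Integrable (fun φ => gibbsWeight J lam φ
      * Real.log (gibbsWeight J lam φ / ((∫ ψ, gibbsWeight J lam ψ) * q φ)))) :
    Real.exp ((∫ φ, gibbsWeight J lam φ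
        * Real.log (gibbsWeight J lam φ / ((∫ ψ, gibbsWeight J lam ψ) * q φ))) / ∫ ψ, gibbsWeight J lam ψ)
        - 1 / 2
      ≤ tauInt (fun k => (∫ φ, ((if 0 ≤ ∑ x, φ x then (1 : ℝ) else -1)
            - gibbsExpect J lam (fun ψ => if 0 ≤ ∑ x, ψ x then (1 : ℝ) else -1))
          * ((imhOpPhi4 J lam q)^[k] (fun ψ => (if 0 ≤ ∑ x, ψ x then (1 : ℝ) else -1)
            - gibbsExpect J lam (fun ψ => if 0 ≤ ∑ x, ψ x then (1 : ℝ) else -1))) φ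
          * gibbsWeight J lam φ)
          / ∫ φ, ((if 0 ≤ ∑ x, φ x then (1 : ℝ) else -1)
            - gibbsExpect J lam (fun ψ => if 0 ≤ ∑ x, ψ x then (1 : ℝ) else -1)) ^ 2
            * gibbsWeight J lam φ) := by
  obtain ⟨hlow, -⟩ := phi4Flow_signM_tauInt_sandwich hlam J hq0 hqm hqi hq1 hW₂
  have hkl := weightMoment_ge_exp_kl (μ := volume) (fun ψ => gibbsWeight_pos J lam ψ)
    (integrable_gibbsWeight hlam J) hq0 hq1 hW₂ hKL
  exact le_trans (sub_le_sub_right hkl _) hlow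

end Lattice


/-! ## The integrability hypothesis discharged: `W₂ < ∞ ⇒ w log(w/(Zq)) ∈ L¹` -/

section Discharge

variable {X : Type*} [MeasurableSpace X] {μ : Measure X} {w q : X → ℝ}

/-- `|log t| ≤ t + 1/t` for `t > 0`. -/
theorem abs_log_le_add_inv {t : ℝ} (ht : 0 < t) : |Real.log t| ≤ t + 1 / t := by
  have h1 : Real.log t ≤ t := (Real.log_le_sub_one_of_pos ht).trans (by linarith)
  have h2 : -Real.log t ≤ 1 / t := by
    rw [← Real.log_inv]
    have := Real.log_le_sub_one_of_pos (inv_pos.mpr ht)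
    rw [one_div]
    linarith
  have h3 : 0 < 1 / t := by positivity
  rw [abs_le]
  constructor <;> linarith

/-- **Square-integrable weights make the relative-entropy integrand integrable**:
`|w log(w/(Zq))| ≤ w²/(Zq) + Z q`, so `W₂ < ∞` (and `∫ q = 1`) give `w log(w/(Zq)) ∈ L¹`. -/
theorem integrable_weight_mul_log (hw0 : ∀ t, 0 < w t) (hwm : Measurable w) (hwi : Integrable w μ)
    (hq0 : ∀ t, 0 < q t) (hqm : Measurable q) (hqi : Integrable q μ) (hq1 : ∫ z, q z ∂μ = 1)
    (hW₂ : Integrable (fun x => w x / q x * w x) μ) :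
    Integrable (fun x => w x * Real.log (w x / ((∫ z, w z ∂μ) * q x))) μ := by
  set Z : ℝ := ∫ z, w z ∂μ with hZdef
  have hZ : 0 < Z := integral_pos_of_pos hw0 hwi hq1
  refine Integrable.mono' ((hW₂.div_const Z).add (hqi.const_mul Z))
    ((hwm.mul (Real.measurable_log.comp (hwm.div (measurable_const.mul hqm)))).aestronglyMeasurable)
    (Eventually.of_forall fun x => ?_)
  have hr : 0 < w x / (Z * q x) := div_pos (hw0 x) (mul_pos hZ (hq0 x))
  have hl := abs_log_le_add_inv hr
  rw [Real.norm_eq_abs, abs_mul, abs_of_nonneg (hw0 x).le]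
  calc w x * |Real.log (w x / (Z * q x))| ≤ w x * (w x / (Z * q x) + 1 / (w x / (Z * q x))) :=
        mul_le_mul_of_nonneg_left hl (hw0 x).le
    _ = w x / q x * w x / Z + Z * q x := by
        have hq := (hq0 x).ne'
        have hw := (hw0 x).ne'
        field_simp
    _ = (fun x => w x / q x * w x / Z) x + (fun x => Z * q x) x := rfl

variable [SFinite μ]

/-- **`τ_int(g) ≥ exp(D(π‖q)) − ½` with no hypothesis beyond square-integrable weights.** -/
theorem imhOp_sign_tauInt_ge_exp_kl' (hw0 : ∀ t, 0 < w t) (hwm : Measurable w)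
    (hwi : Integrable w μ) (hq0 : ∀ t, 0 < q t) (hqm : Measurable q) (hqi : Integrable q μ)
    (hq1 : ∫ z, q z ∂μ = 1) (hW₂ : Integrable (fun x => w x / q x * w x) μ)
    {g : X → ℝ} (hgm : Measurable g) (hg1 : ∀ t, g t ^ 2 = 1) (hg0 : ∫ x, g x * w x ∂μ = 0) :
    Real.exp ((∫ x, w x * Real.log (w x / ((∫ z, w z ∂μ) * q x)) ∂μ) / ∫ z, w z ∂μ) - 1 / 2
      ≤ tauInt (fun k => (∫ x, g x * ((imhOp μ w q)^[k] g) x * w x ∂μ)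
          / ∫ x, g x ^ 2 * w x ∂μ) :=
  imhOp_sign_tauInt_ge_exp_kl hw0 hwm hwi hq0 hqm hqi hq1 hW₂
    (integrable_weight_mul_log hw0 hwm hwi hq0 hqm hqi hq1 hW₂) hgm hg1 hg0

end Discharge

section LatticeDischarge

variable {n : ℕ}

/-- **φ⁴, every model with square-integrable weights: `τ_int(sgn M) ≥ e^{D(π‖q̃)} − ½`** — the
integrability of `e^{−S} log(e^{−S}/(Zq̃))` is automatic. -/
theorem phi4Flow_signM_tauInt_ge_exp_kl' {lam : ℝ} (hlam : 0 < lam)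
    (J : Fin (n + 1) → Fin (n + 1) → ℝ) {q : (Fin (n + 1) → ℝ) → ℝ} (hq0 : ∀ φ, 0 < q φ)
    (hqm : Measurable q) (hqi : Integrable q) (hq1 : ∫ φ, q φ = 1)
    (hW₂ : Integrable (fun φ => gibbsWeight J lam φ / q φ * gibbsWeight J lam φ)) :
    Real.exp ((∫ φ, gibbsWeight J lam φ
        * Real.log (gibbsWeight J lam φ / ((∫ ψ, gibbsWeight J lam ψ) * q φ))) / ∫ ψ, gibbsWeight J lam ψ)
        - 1 / 2
      ≤ tauInt (fun k => (∫ φ, ((if 0 ≤ ∑ x, φ x then (1 : ℝ) else -1)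
            - gibbsExpect J lam (fun ψ => if 0 ≤ ∑ x, ψ x then (1 : ℝ) else -1))
          * ((imhOpPhi4 J lam q)^[k] (fun ψ => (if 0 ≤ ∑ x, ψ x then (1 : ℝ) else -1)
            - gibbsExpect J lam (fun ψ => if 0 ≤ ∑ x, ψ x then (1 : ℝ) else -1))) φ
          * gibbsWeight J lam φ)
          / ∫ φ, ((if 0 ≤ ∑ x, φ x then (1 : ℝ) else -1)
            - gibbsExpect J lam (fun ψ => if 0 ≤ ∑ x, ψ x then (1 : ℝ) else -1)) ^ 2
            * gibbsWeight J lam φ) :=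
  phi4Flow_signM_tauInt_ge_exp_kl hlam J hq0 hqm hqi hq1 hW₂
    (integrable_weight_mul_log (μ := volume) (fun ψ => gibbsWeight_pos J lam ψ)
      (continuous_gibbsWeight J lam).measurable (integrable_gibbsWeight hlam J) hq0 hqm hqi hq1 hW₂)

end LatticeDischarge

end Summit.Ventures.LatticeQCDFlow.Exactness
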